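import Summits.FinalStateConjecture.FinalStateConjecture.Theorems.EIHFluxBalanceInertialRecessionStubEndgameBasics

/-!
# Route EIHFluxBalance — crux `InertialRecession`, line `sublinear-is-free-clean-window-charges`:
# elementary limit and slowness facts for the increment oracle's assembly

Helper file for the crux `stmt-FinalStateConjecture-10166`
(`Summit.FinalStateConjecture.FinalStateConjecture.Theses.EIHFluxBalance.InertialRecession`), registered stub `stub_incrementOracle`
(lead reshape r9/r10) of `Cruxes/InertialRecession/Lines/sublinear_is_free_clean_window_charges.lean`; used by the oracle ASSEMBLY
(`…OracleAssemble`): the window law and the identification hold above ANY threshold `ρ → ∞`; the oracle picks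
`ρ(t) = min(√t, min_{i≠j}‖ξᵢ(t) − ξⱼ(t)‖/3)` (defined locally there), which tends to `∞` with the pairwise distances
(`ChargeModel.tendsto_min_atTop_atTop` of `…StubIdentificationRates`, `tendsto_inf'_dist_div_atTop`). Also: two-point slowness of a distance from a derivative bound
(`abs_dist_sub_dist_le_of_deriv`).
-/

noncomputable section

set_option linter.dupNamespace false

open Filter Topology Set
open scoped Topology BigOperators

namespace Summit.FinalStateConjecture.FinalStateConjecture.Theorems.SublinearIsFree.Oracle

open Literature.Geometry.Lorentzian

/-- A finite nonempty `inf'` of pairwise distances (divided by `3`) tends to `+∞` when every distance does. [folklore] -/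
theorem tendsto_inf'_dist_div_atTop {N : ℕ} (ξ : Fin N → ℝ → E3) (G : Finset (Fin N × Fin N)) (hG : G.Nonempty)
    (hoff : ∀ p ∈ G, p.1 ≠ p.2) (hsep : ∀ i j, i ≠ j → Tendsto (fun t ↦ ‖ξ i t - ξ j t‖) atTop atTop) :
    Tendsto (fun t ↦ G.inf' hG fun p ↦ ‖ξ p.1 t - ξ p.2 t‖ / 3) atTop atTop := by
  rw [tendsto_atTop_atTop]
  intro b
  have hev : ∀ᶠ t in atTop, ∀ p ∈ G, b ≤ ‖ξ p.1 t - ξ p.2 t‖ / 3 := by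
    rw [Filter.eventually_all_finset]
    intro p hp
    have := (hsep p.1 p.2 (hoff p hp)).atTop_div_const (by norm_num : (0 : ℝ) < 3)
    exact (tendsto_atTop.mp this) b
  obtain ⟨T, hT⟩ := eventually_atTop.mp hev
  exact ⟨T, fun t ht ↦ Finset.le_inf' _ _ fun p hp ↦ hT t ht p hp⟩

/-- TWO-POINT SLOWNESS OF A DISTANCE: if `‖(ξₖ − ξₗ)′‖ ≤ σ` on `[a,b]` then `|‖ξₖ − ξₗ‖(s′) − ‖ξₖ − ξₗ‖(s)| ≤ σ(s′ − s)` for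
`a ≤ s ≤ s′ ≤ b`. [folklore] -/
theorem abs_dist_sub_dist_le_of_deriv {ξk ξl : ℝ → E3} (hk : Differentiable ℝ ξk) (hl : Differentiable ℝ ξl) {a b σ : ℝ}
    (hb : ∀ s ∈ Icc a b, ‖deriv ξk s - deriv ξl s‖ ≤ σ) {s s' : ℝ} (hs : s ∈ Icc a b) (hs' : s' ∈ Icc a b) (hss' : s ≤ s') :
    |‖ξk s' - ξl s'‖ - ‖ξk s - ξl s‖| ≤ σ * (s' - s) := by
  have hd : ∀ x ∈ Icc s s', HasDerivWithinAt (fun t ↦ ξk t - ξl t) (deriv ξk x - deriv ξl x) (Icc s s') x := fun x _ ↦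
    (((hk x).hasDerivAt).sub ((hl x).hasDerivAt)).hasDerivWithinAt
  have hbound : ∀ x ∈ Ico s s', ‖deriv ξk x - deriv ξl x‖ ≤ σ := fun x hx ↦
    hb x ⟨hs.1.trans hx.1, hx.2.le.trans hs'.2⟩
  have h := norm_image_sub_le_of_norm_deriv_le_segment' hd hbound s' (right_mem_Icc.mpr hss')
  calc |‖ξk s' - ξl s'‖ - ‖ξk s - ξl s‖| ≤ ‖(ξk s' - ξl s') - (ξk s - ξl s)‖ := abs_norm_sub_norm_le _ _
    _ ≤ σ * (s' - s) := h

/-- Registered helper form of `abs_dist_sub_dist_le_of_deriv` for globally bounded derivative (carrier of this file). [folklore] -/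
theorem oracle_abs_dist_sub_dist_le : ∀ (ξk ξl : ℝ → E3) (a b σ : ℝ), Differentiable ℝ ξk → Differentiable ℝ ξl →
    (∀ s ∈ Set.Icc a b, ‖deriv ξk s - deriv ξl s‖ ≤ σ) → ∀ s ∈ Set.Icc a b, ∀ s' ∈ Set.Icc a b, s ≤ s' →
    |‖ξk s' - ξl s'‖ - ‖ξk s - ξl s‖| ≤ σ * (s' - s) :=
  fun _ _ _ _ _ hk hl hb _ hs _ hs' hss' ↦ abs_dist_sub_dist_le_of_deriv hk hl hb hs hs' hss'

end Summit.FinalStateConjecture.FinalStateConjecture.Theorems.SublinearIsFree.Oracle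

end
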